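import Mathlib

/-!
# Residue classes do not interfere in monomial interpolation determinants (solo-ABC-informed, s9)

Sharpest-statement artefact for `Summit.ABC` (family `abc`, soloist `solo-ABC-informed`):
*Theorem F* of `paper.md` §2.3 — door (B-i) ("`p`-adic interpolation across residue discs") typed
at the level of the interpolation determinants of the two-logarithm method.

In Bugeaud–Laurent's method the auxiliary matrix is the **bivariate Vandermonde matrix**
`[u_j ^ k · y_j ^ ℓ]`, rows `(k, ℓ) ∈ [0,K) × [0,L)`, at the nodes `(u_j, y_j)` with
`u_j = r_j b₂ + s_j b₁ ∈ ℤ` and `y_j = α₁^{r_j} α₂^{s_j}` a `p`-adic unit.  The nodes fall into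
*residue classes*: `y_j ≡ y_{j'} (mod p)` iff `(r_j - r_{j'}, s_j - s_{j'})` lies in the relation
lattice `Λ = {(m,n) : ᾱ₁^m ᾱ₂^n = 1}` of covolume `g = |⟨ᾱ₁, ᾱ₂⟩|` (`soloInformed_sameClass_iff`).
All `p`-adic smallness of such a determinant that the method uses is *confluence inside one
class* (BL's hypothesis (1b); Theorem E, `SoloInformedTwoLogFloor.lean`, shows that inside BL's
theorem this forces `g·h₁h₂ < 10 K log²p`).  This file proves that in the configurations where
the question is decidable by algebra alone, points in *different* classes contribute **nothing**,
and calibrates what ONE class gives: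

* `soloInformed_vandermonde_padicValInt_sameClass` (**F₀**, pure exponential rows, `K = 1`):
  `v_p det [y_j^ℓ] = Σ_{i<j, y_i ≡ y_j (p)} v_p (y_j - y_i)` — the valuation is exactly the sum of the
  within-class terms; every cross-class pair contributes `0` (`soloInformed_crossClass_pair`).
* `soloInformed_biVandermonde_det` / `soloInformed_crossClass_unit` (**F₁**): if the `K·L` nodes
  consist of `K` nodes in each of `L` distinct classes, the `u`-values being distinct mod `p` inside
  each class, then `det [u_j^k y_j^ℓ] = det V(x)^K · ∏_c det V(u_c)` over the residue field and the
  integer determinant is a `p`-adic **unit**: zero smallness, although the same `K·L` nodes placed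
  in ONE class give valuation `≥ K·L(L-1)/2` (F₂; `≍ K²L²/2` once the linear form is small).
* `soloInformed_oneClass_factor` / `_dvd` / `_padicValInt` / `_exact` (**F₂**): if all `K·L`
  nodes lie in one class, `y_j = x + p t_j`, then `det [u_j^k y_j^ℓ] = p^{K·L(L-1)/2}·det [u_j^k t_j^ℓ]`
  identically (translation invariance `y ↦ y - x` by the unitriangular binomial matrix, then row
  scaling); so `p^{K·C(L,2)}` divides the determinant, and the valuation is exactly `K·C(L,2)` when
  the first digits `(u_j, t_j mod p)` are in F₁-position — the unconditional one-class smallness is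
  `K·C(L,2)`, block by block, with no cross terms.

Consequences (paper §2.3, Theorem F; claim C31): BL's one-class restriction is not a restriction of
convenience; for monomial interpolation determinants the (B-i) door at `n = 2` would need forced
`𝔭`-divisibility of character-twisted Hermite determinants, for which no mechanism is known.
References: Bugeaud–Laurent, J. Number Theory 61 (1996) 311–342, §4; M. Laurent, Acta Arith. 66
(1994) (interpolation determinants); folklore (Vandermonde).  All statements below are elementary.
-/

open Finset Matrix
open scoped Kronecker

namespace Summit.ABC.ABC.Theorems

/-! ### F₁: the bivariate Vandermonde determinant of a `K`-per-class configuration -/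

/-- **Theorem F₁ (algebraic form).** For nodes indexed by `(i, c) ∈ Fin K × Fin L` whose second
coordinate depends only on the class `c` (`x c`) and whose first coordinate is `u c i`, the
bivariate Vandermonde matrix `A_{(k,ℓ),(i,c)} = (u c i)^k (x c)^ℓ` factors as
`(1 ⊗ V(x)ᵀ) · blockDiagonal (V(u_c)ᵀ)`, hence `det A = det V(x)^K · ∏_c det V(u_c)`. [folklore] -/
theorem soloInformed_biVandermonde_det {F : Type*} [CommRing F] {K L : ℕ}
    (u : Fin L → Fin K → F) (x : Fin L → F) (A : Matrix (Fin K × Fin L) (Fin K × Fin L) F)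
    (hA : ∀ k ℓ i c, A (k, ℓ) (i, c) = u c i ^ (k : ℕ) * x c ^ (ℓ : ℕ)) :
    A.det = (vandermonde x).det ^ K * ∏ c, (vandermonde (u c)).det := by
  classical
  set T : Matrix (Fin K × Fin L) (Fin K × Fin L) F :=
    (1 : Matrix (Fin K) (Fin K) F) ⊗ₖ (vandermonde x)ᵀ with hT
  set B : Matrix (Fin K × Fin L) (Fin K × Fin L) F :=
    blockDiagonal fun c => (vandermonde (u c))ᵀ with hB
  have hTB : A = T * B := by
    ext ⟨k, ℓ⟩ ⟨i, c⟩
    rw [Matrix.mul_apply, hA, Fintype.sum_prod_type]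
    simp only [hT, hB, kroneckerMap_apply, Matrix.one_apply, transpose_apply, vandermonde_apply,
      blockDiagonal_apply', boole_mul, mul_ite, mul_zero]
    simp only [Finset.sum_ite_eq', Finset.mem_univ, if_true]
    rw [Finset.sum_eq_single k]
    · simp [mul_comm]
    · intro k' _ hk'
      simp [Ne.symm hk']
    · simp
  rw [hTB, det_mul, hT, det_kronecker, hB, det_blockDiagonal]
  simp [det_transpose, Fintype.card_fin]

/-- **Theorem F₁ (non-vanishing over a domain).** With `x` injective (the `L` classes are distinct)
and each `u c` injective (inside each class the `K` first coordinates are distinct) the bivariate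
Vandermonde determinant is non-zero. [folklore] -/
theorem soloInformed_biVandermonde_det_ne_zero {F : Type*} [CommRing F] [IsDomain F] {K L : ℕ}
    (u : Fin L → Fin K → F) (x : Fin L → F) (A : Matrix (Fin K × Fin L) (Fin K × Fin L) F)
    (hA : ∀ k ℓ i c, A (k, ℓ) (i, c) = u c i ^ (k : ℕ) * x c ^ (ℓ : ℕ))
    (hx : Function.Injective x) (hu : ∀ c, Function.Injective (u c)) : A.det ≠ 0 := by
  rw [soloInformed_biVandermonde_det u x A hA]
  refine mul_ne_zero (pow_ne_zero _ (det_vandermonde_ne_zero_iff.mpr hx)) ?_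
  exact Finset.prod_ne_zero_iff.mpr fun c _ => det_vandermonde_ne_zero_iff.mpr (hu c)

/-- **Theorem F₁ (the `p`-adic statement).** Let the `K·L` integer nodes `(u_j, y_j)`,
`j = (i, c) ∈ Fin K × Fin L`, satisfy: `y_{(i,c)} ≡ x_c (mod p)` with `x : Fin L → 𝔽_p` injective
(node `(i,c)` lies in residue class `c`, the `L` classes are distinct) and, for each class `c`, the
`u_{(i,c)}`, `i < K`, are distinct mod `p`.  Then the monomial interpolation determinant
`det [u_j^k y_j^ℓ]_{(k,ℓ), j}` is **not divisible by `p`**: a configuration spread over `L` classes,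
`K` nodes per class, carries no `p`-adic smallness at all. [folklore; paper.md §2.3 Theorem F] -/
theorem soloInformed_crossClass_unit {p : ℕ} [Fact p.Prime] {K L : ℕ}
    (u y : Fin K × Fin L → ℤ) (x : Fin L → ZMod p) (hx : Function.Injective x)
    (hy : ∀ i c, ((y (i, c) : ℤ) : ZMod p) = x c)
    (hu : ∀ c, Function.Injective fun i : Fin K => ((u (i, c) : ℤ) : ZMod p))
    (M : Matrix (Fin K × Fin L) (Fin K × Fin L) ℤ)
    (hM : ∀ k ℓ j, M (k, ℓ) j = u j ^ (k : ℕ) * y j ^ (ℓ : ℕ)) :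
    ¬ (p : ℤ) ∣ M.det := by
  intro hdiv
  have hA := soloInformed_biVandermonde_det_ne_zero (F := ZMod p)
    (fun c i => ((u (i, c) : ℤ) : ZMod p)) x (M.map (Int.castRingHom (ZMod p)))
    (fun k ℓ i c => by simp [Matrix.map_apply, hM, hy]) hx hu
  apply hA
  rw [← RingHom.mapMatrix_apply, ← RingHom.map_det]
  simpa using (ZMod.intCast_zmod_eq_zero_iff_dvd M.det p).mpr hdiv

/-- Corollary of F₁ in valuation form: `v_p (det M) = 0`. [folklore] -/
theorem soloInformed_crossClass_padicValInt_zero {p : ℕ} [Fact p.Prime] {K L : ℕ}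
    (u y : Fin K × Fin L → ℤ) (x : Fin L → ZMod p) (hx : Function.Injective x)
    (hy : ∀ i c, ((y (i, c) : ℤ) : ZMod p) = x c)
    (hu : ∀ c, Function.Injective fun i : Fin K => ((u (i, c) : ℤ) : ZMod p))
    (M : Matrix (Fin K × Fin L) (Fin K × Fin L) ℤ)
    (hM : ∀ k ℓ j, M (k, ℓ) j = u j ^ (k : ℕ) * y j ^ (ℓ : ℕ)) :
    padicValInt p M.det = 0 :=
  padicValInt.eq_zero_of_not_dvd (soloInformed_crossClass_unit u y x hx hy hu M hM)

/-! ### F₀: pure exponential rows (`K = 1`): the valuation is the within-class sum -/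

/-- `v_p` of a finite product of non-zero integers is the sum of the valuations. [folklore] -/
theorem soloInformed_padicValInt_prod {p : ℕ} [Fact p.Prime] {ι : Type*} (s : Finset ι)
    (f : ι → ℤ) (hf : ∀ i ∈ s, f i ≠ 0) :
    padicValInt p (∏ i ∈ s, f i) = ∑ i ∈ s, padicValInt p (f i) := by
  classical
  induction s using Finset.induction_on with
  | empty => simp [padicValInt.one]
  | insert a s ha ih =>
    rw [Finset.prod_insert ha, Finset.sum_insert ha,
      padicValInt.mul (hf a (by simp)) (Finset.prod_ne_zero_iff.mpr fun i hi => hf i (by simp [hi])),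
      ih fun i hi => hf i (by simp [hi])]

/-- A **cross-class pair contributes nothing**: if `a ≢ b (mod p)` then `v_p (b - a) = 0`.
[folklore] -/
theorem soloInformed_crossClass_pair {p : ℕ} [Fact p.Prime] (a b : ℤ)
    (h : (a : ZMod p) ≠ (b : ZMod p)) : padicValInt p (b - a) = 0 := by
  apply padicValInt.eq_zero_of_not_dvd
  intro hd
  exact h ((ZMod.intCast_eq_intCast_iff_dvd_sub a b p).mpr hd)

/-- **Theorem F₀ (Vandermonde form).** For distinct integer nodes `y_j` the `p`-adic valuation of
the Vandermonde determinant `det [y_j^ℓ]` is the sum over all pairs of `v_p (y_j - y_i)`.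
[folklore] -/
theorem soloInformed_vandermonde_padicValInt {p : ℕ} [Fact p.Prime] {N : ℕ} (y : Fin N → ℤ)
    (hy : Function.Injective y) :
    padicValInt p (vandermonde y).det = ∑ i : Fin N, ∑ j ∈ Ioi i, padicValInt p (y j - y i) := by
  rw [det_vandermonde]
  rw [soloInformed_padicValInt_prod _ _ fun i _ =>
    Finset.prod_ne_zero_iff.mpr fun j hj => sub_ne_zero.mpr fun h => (mem_Ioi.mp hj).ne' (hy h)]
  refine Finset.sum_congr rfl fun i _ => ?_
  exact soloInformed_padicValInt_prod _ _ fun j hj =>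
    sub_ne_zero.mpr fun h => (mem_Ioi.mp hj).ne' (hy h)

/-- **Theorem F₀ (residue classes do not interfere, `K = 1`).** For distinct integer nodes `y_j`
(`p`-adic units or not) the valuation of `det [y_j^ℓ]` is the sum of `v_p (y_j - y_i)` over the
pairs `i < j` lying in the SAME residue class mod `p`; pairs in different classes contribute `0`.
In the two-logarithm setting `y_j = α₁^{r_j} α₂^{s_j}` and "same class" means
`(r_j - r_i, s_j - s_i) ∈ Λ` (`soloInformed_sameClass_iff`). [paper.md §2.3 Theorem F] -/
theorem soloInformed_vandermonde_padicValInt_sameClass {p : ℕ} [Fact p.Prime] {N : ℕ}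
    (y : Fin N → ℤ) (hy : Function.Injective y) :
    padicValInt p (vandermonde y).det =
      ∑ i : Fin N, ∑ j ∈ (Ioi i).filter (fun j => (y j : ZMod p) = (y i : ZMod p)),
        padicValInt p (y j - y i) := by
  rw [soloInformed_vandermonde_padicValInt y hy]
  refine Finset.sum_congr rfl fun i _ => ?_
  rw [← Finset.sum_filter_add_sum_filter_not (Ioi i) (fun j => (y j : ZMod p) = (y i : ZMod p))]
  have h0 : ∑ j ∈ (Ioi i).filter (fun j => ¬ (y j : ZMod p) = (y i : ZMod p)),
      padicValInt p (y j - y i) = 0 :=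
    Finset.sum_eq_zero fun j hj =>
      soloInformed_crossClass_pair (y i) (y j) (Ne.symm (Finset.mem_filter.mp hj).2)
  rw [h0, add_zero]

/-! ### F₂: one residue class — the exact factor `p ^ (K·L(L-1)/2)` -/

/-- Truncated binomial identity: for `ℓ < L`, `Σ_{m<L} y^m a^{ℓ-m} C(ℓ,m) = (y + a)^ℓ`
(the terms with `m > ℓ` vanish). [folklore] -/
theorem soloInformed_sum_fin_binomial {R : Type*} [CommRing R] {L : ℕ} (ℓ : Fin L) (y a : R) :
    ∑ m : Fin L, y ^ (m : ℕ) * a ^ ((ℓ : ℕ) - m) * ((ℓ : ℕ).choose m : R) = (y + a) ^ (ℓ : ℕ) := by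
  rw [Fin.sum_univ_eq_sum_range (fun m => y ^ m * a ^ ((ℓ : ℕ) - m) * ((ℓ : ℕ).choose m : R)) L,
    add_pow]
  symm
  have hsub : Finset.range ((ℓ : ℕ) + 1) ⊆ Finset.range L :=
    Finset.range_subset_range.mpr (Nat.succ_le_of_lt ℓ.2)
  refine Finset.sum_subset hsub ?_
  intro m hm hm'
  have hlt : (ℓ : ℕ) < m := by
    simp only [Finset.mem_range, not_lt] at hm hm'
    omega
  simp [Nat.choose_eq_zero_of_lt hlt]

/-- **Translation invariance in the exponential variable.** The bivariate Vandermonde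
determinant is unchanged under `y_j ↦ y_j + a`:  `det [u_j^k (y_j + a)^ℓ] = det [u_j^k y_j^ℓ]`
(the row change of basis is `1 ⊗ Bin(a)`, `Bin(a)_{ℓ m} = C(ℓ,m) a^{ℓ-m}` unitriangular).
[folklore] -/
theorem soloInformed_biVandermonde_translate {R : Type*} [CommRing R] {K L : ℕ}
    (u y : Fin K × Fin L → R) (a : R) (M N : Matrix (Fin K × Fin L) (Fin K × Fin L) R)
    (hM : ∀ k ℓ j, M (k, ℓ) j = u j ^ (k : ℕ) * (y j + a) ^ (ℓ : ℕ))
    (hN : ∀ k ℓ j, N (k, ℓ) j = u j ^ (k : ℕ) * y j ^ (ℓ : ℕ)) : M.det = N.det := by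
  classical
  set Bin : Matrix (Fin L) (Fin L) R :=
    Matrix.of fun ℓ m => a ^ ((ℓ : ℕ) - (m : ℕ)) * ((ℓ : ℕ).choose m : R) with hBin
  have hBin_det : Bin.det = 1 := by
    rw [det_of_lowerTriangular Bin]
    · simp [hBin]
    · intro i j hij
      have hlt : (i : ℕ) < j := by simpa using hij
      simp [hBin, Nat.choose_eq_zero_of_lt hlt]
  have hMPN : M = ((1 : Matrix (Fin K) (Fin K) R) ⊗ₖ Bin) * N := by
    ext ⟨k, ℓ⟩ j
    rw [Matrix.mul_apply, Fintype.sum_prod_type, Finset.sum_eq_single k]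
    · simp only [kroneckerMap_apply, Matrix.one_apply_eq, one_mul, hBin, of_apply, hN, hM]
      rw [← soloInformed_sum_fin_binomial ℓ (y j) a, Finset.mul_sum]
      exact Finset.sum_congr rfl fun m _ => by ring
    · intro k' _ hk'
      simp [kroneckerMap_apply, Matrix.one_apply_ne (Ne.symm hk')]
    · simp
  rw [hMPN, det_mul, det_kronecker, hBin_det]
  simp

/-- **Row scaling.** `det [u_j^k (p t_j)^ℓ] = p^{K·L(L-1)/2} · det [u_j^k t_j^ℓ]`: row `(k,ℓ)` carries
the factor `p^ℓ`, and `Σ_{(k,ℓ)} ℓ = K · L(L-1)/2`. [folklore] -/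
theorem soloInformed_biVandermonde_scale {R : Type*} [CommRing R] {K L : ℕ}
    (u t : Fin K × Fin L → R) (p : R) (N N' : Matrix (Fin K × Fin L) (Fin K × Fin L) R)
    (hN : ∀ k ℓ j, N (k, ℓ) j = u j ^ (k : ℕ) * (p * t j) ^ (ℓ : ℕ))
    (hN' : ∀ k ℓ j, N' (k, ℓ) j = u j ^ (k : ℕ) * t j ^ (ℓ : ℕ)) :
    N.det = p ^ (K * (L * (L - 1) / 2)) * N'.det := by
  have hNN' : N = Matrix.of fun (i : Fin K × Fin L) j => p ^ (i.2 : ℕ) * N' i j := by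
    ext ⟨k, ℓ⟩ j
    simp only [of_apply, hN, hN']
    ring
  rw [hNN', det_mul_column]
  congr 1
  rw [Finset.prod_pow_eq_pow_sum, Fintype.sum_prod_type]
  simp only [Finset.sum_const, Finset.card_univ, Fintype.card_fin, smul_eq_mul]
  have hsum : ∑ ℓ : Fin L, (ℓ : ℕ) = ∑ m ∈ Finset.range L, m :=
    Fin.sum_univ_eq_sum_range (fun m => m) L
  rw [hsum, Finset.sum_range_id]

/-- **Theorem F₂ (one class: exact factorisation).** If all `K·L` nodes lie in ONE residue class,
`y_j = x + p·t_j`, then `det [u_j^k y_j^ℓ] = p^{K·L(L-1)/2} · det [u_j^k t_j^ℓ]` identically (any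
commutative ring, any `p`).  The residual determinant is again a bivariate Vandermonde determinant,
at the nodes `(u_j, t_j)`. [paper.md §2.3 Theorem F] -/
theorem soloInformed_oneClass_factor {R : Type*} [CommRing R] {K L : ℕ}
    (u y t : Fin K × Fin L → R) (x p : R) (hy : ∀ j, y j = x + p * t j)
    (M N' : Matrix (Fin K × Fin L) (Fin K × Fin L) R)
    (hM : ∀ k ℓ j, M (k, ℓ) j = u j ^ (k : ℕ) * y j ^ (ℓ : ℕ))
    (hN' : ∀ k ℓ j, N' (k, ℓ) j = u j ^ (k : ℕ) * t j ^ (ℓ : ℕ)) :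
    M.det = p ^ (K * (L * (L - 1) / 2)) * N'.det := by
  set N : Matrix (Fin K × Fin L) (Fin K × Fin L) R :=
    Matrix.of fun i j => u j ^ (i.1 : ℕ) * (p * t j) ^ (i.2 : ℕ) with hN
  rw [soloInformed_biVandermonde_translate u (fun j => p * t j) x M N
      (fun k ℓ j => by rw [hM, hy, add_comm]) (fun k ℓ j => by simp [hN]),
    soloInformed_biVandermonde_scale u t p N N' (fun k ℓ j => by simp [hN]) hN']

/-- `v_p (p^n) = n` for integers. [folklore] -/
theorem soloInformed_padicValInt_prime_pow {p : ℕ} [Fact p.Prime] (n : ℕ) :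
    padicValInt p ((p : ℤ) ^ n) = n := by
  rw [← Nat.cast_pow, padicValInt.of_nat, padicValNat.prime_pow]

/-- **Theorem F₂ (divisibility).** One class ⇒ `p^{K·L(L-1)/2} ∣ det [u_j^k y_j^ℓ]`: the within-class
smallness of `K·L` nodes is at least `K·C(L,2)`, before any hypothesis on the linear form is used.
[paper.md §2.3 Theorem F] -/
theorem soloInformed_oneClass_dvd {p : ℕ} {K L : ℕ} (u y t : Fin K × Fin L → ℤ) (x : ℤ)
    (hy : ∀ j, y j = x + p * t j) (M : Matrix (Fin K × Fin L) (Fin K × Fin L) ℤ)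
    (hM : ∀ k ℓ j, M (k, ℓ) j = u j ^ (k : ℕ) * y j ^ (ℓ : ℕ)) :
    (p : ℤ) ^ (K * (L * (L - 1) / 2)) ∣ M.det :=
  Dvd.intro _ (soloInformed_oneClass_factor u y t x (p : ℤ) hy M
    (Matrix.of fun i j => u j ^ (i.1 : ℕ) * t j ^ (i.2 : ℕ)) hM (fun _ _ _ => rfl)).symm

/-- **Theorem F₂ (exact valuation).** One class and a non-singular residual ⇒
`v_p det [u_j^k y_j^ℓ] = K·L(L-1)/2 + v_p det [u_j^k t_j^ℓ]`. [paper.md §2.3 Theorem F] -/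
theorem soloInformed_oneClass_padicValInt {p : ℕ} [Fact p.Prime] {K L : ℕ}
    (u y t : Fin K × Fin L → ℤ) (x : ℤ) (hy : ∀ j, y j = x + p * t j)
    (M N' : Matrix (Fin K × Fin L) (Fin K × Fin L) ℤ)
    (hM : ∀ k ℓ j, M (k, ℓ) j = u j ^ (k : ℕ) * y j ^ (ℓ : ℕ))
    (hN' : ∀ k ℓ j, N' (k, ℓ) j = u j ^ (k : ℕ) * t j ^ (ℓ : ℕ)) (hN'0 : N'.det ≠ 0) :
    padicValInt p M.det = K * (L * (L - 1) / 2) + padicValInt p N'.det := by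
  rw [soloInformed_oneClass_factor u y t x (p : ℤ) hy M N' hM hN',
    padicValInt.mul (pow_ne_zero _ (by exact_mod_cast (Fact.out : p.Prime).ne_zero)) hN'0,
    soloInformed_padicValInt_prime_pow]

/-- **Theorem F₂ + F₁ (the generic one-class value is attained).** If the `K·L` nodes lie in one
class, `y_j = x + p·t_j`, and the first digits `t_j mod p` are themselves in `F₁`-position
(`K` nodes on each of `L` distinct values, `u` distinct mod `p` along each), then
`v_p det [u_j^k y_j^ℓ] = K·L(L-1)/2` exactly: the one-class smallness `K·C(L,2)` of the uncollapsed
model is sharp. [paper.md §2.3 Theorem F] -/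
theorem soloInformed_oneClass_exact {p : ℕ} [Fact p.Prime] {K L : ℕ}
    (u y t : Fin K × Fin L → ℤ) (x : ℤ) (hy : ∀ j, y j = x + p * t j)
    (x' : Fin L → ZMod p) (hx' : Function.Injective x')
    (ht : ∀ i c, ((t (i, c) : ℤ) : ZMod p) = x' c)
    (hu : ∀ c, Function.Injective fun i : Fin K => ((u (i, c) : ℤ) : ZMod p))
    (M : Matrix (Fin K × Fin L) (Fin K × Fin L) ℤ)
    (hM : ∀ k ℓ j, M (k, ℓ) j = u j ^ (k : ℕ) * y j ^ (ℓ : ℕ)) :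
    padicValInt p M.det = K * (L * (L - 1) / 2) := by
  set N' : Matrix (Fin K × Fin L) (Fin K × Fin L) ℤ :=
    Matrix.of fun i j => u j ^ (i.1 : ℕ) * t j ^ (i.2 : ℕ) with hN'd
  have hN' : ∀ k ℓ j, N' (k, ℓ) j = u j ^ (k : ℕ) * t j ^ (ℓ : ℕ) := fun k ℓ j => rfl
  have hunit := soloInformed_crossClass_unit u t x' hx' ht hu N' hN'
  have hN'0 : N'.det ≠ 0 := fun h => hunit (h ▸ dvd_zero _)
  rw [soloInformed_oneClass_padicValInt u y t x hy M N' hM hN' hN'0,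
    soloInformed_crossClass_padicValInt_zero u t x' hx' ht hu N' hN', add_zero]

/-! ### The dictionary: residue classes of the nodes = cosets of the relation lattice -/

/-- Two nodes `α₁^r α₂^s`, `α₁^{r'} α₂^{s'}` (units of a commutative group, e.g. `𝔽_pˣ`) coincide
iff the difference of exponent vectors is a relation: `(r - r', s - s') ∈ Λ`. [folklore] -/
theorem soloInformed_sameClass_iff {G : Type*} [CommGroup G] (a₁ a₂ : G) (r s r' s' : ℤ) :
    a₁ ^ r * a₂ ^ s = a₁ ^ r' * a₂ ^ s' ↔ a₁ ^ (r - r') * a₂ ^ (s - s') = 1 := by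
  rw [_root_.zpow_sub, _root_.zpow_sub,
    show a₁ ^ r * (a₁ ^ r')⁻¹ * (a₂ ^ s * (a₂ ^ s')⁻¹) = (a₁ ^ r * a₂ ^ s) * (a₁ ^ r' * a₂ ^ s')⁻¹ by
      rw [mul_inv]; ac_rfl,
    mul_inv_eq_one]

/-- Cross-class pairs of two-logarithm nodes are `p`-adic units: if
`ᾱ₁^r ᾱ₂^s ≠ ᾱ₁^{r'} ᾱ₂^{s'}` in `𝔽_p` then `p ∤ α₁^{r'} α₂^{s'} - α₁^r α₂^s`. [folklore] -/
theorem soloInformed_crossClass_pair_nodes {p : ℕ} [Fact p.Prime] (α₁ α₂ : ℤ) (r s r' s' : ℕ)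
    (h : (α₁ : ZMod p) ^ r * (α₂ : ZMod p) ^ s ≠ (α₁ : ZMod p) ^ r' * (α₂ : ZMod p) ^ s') :
    padicValInt p (α₁ ^ r' * α₂ ^ s' - α₁ ^ r * α₂ ^ s) = 0 := by
  apply soloInformed_crossClass_pair
  push_cast
  exact h

end Summit.ABC.ABC.Theorems
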